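import Summits.AtomisticToContinuum.FouriersLaw.Theorems.OddSectorIrreversibilityTapLeakBoundBlockConePrelim

/-!
# `TapLeakBound` (stmt-AtomisticToContinuum-15159), line `SketchIdeator2`: block light cone — the per-site discrepancy inequalities

Helper file (`--supports stmt-AtomisticToContinuum-15159`) for crux
P = `Summit.AtomisticToContinuum.FouriersLaw.Theses.OddSectorIrreversibility.TapLeakBound`, registered stub `stub_kickCone`
(C′ `ResampledKickCone`). The stub's open content is an `N`-uniform propagation estimate for the CLOSED pinned FPU-β
chain in Gibbs equilibrium; this file lands its deterministic, `N`-UNIFORM core (companion of `…BlockConePrelim.lean`):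
for two trajectories `Φ_t x`, `Φ_t y` of `detFlow` whose positions stay in the box `|q_k| ≤ R` on the sites `k ≤ L + 1`
of a block during `[0, s]` (the discrepancies `dq_n = |δq_n|`, `dp_n = |δp_n|` are passed as functions with defining
hypotheses — no new definitions):

* `a_le_box` — `a_n = Λ dq_n + dp_n` obeys `a_n(t) ≤ a_n(0) + ∫₀ᵗ (Λ(a_{n-1} + 3a_n) + Λ² dq_{n+1})` for `n ≤ L`;
* `block_cone` — the two-sided geometrically weighted functional `S(t) = Σ_{n ≤ L} θ^{|n-i|} a_n(t)` (`0 < θ ≤ 1`) satisfies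
  `S(t) ≤ (S(0) + 2RΛ² θ^{|L-i|} t) · exp(Λ(4 + 2/θ)t)`: the rest of the chain enters ONLY through the capped source
  `dq_{L+1} ≤ 2R` at the block boundary (generating-function / Grönwall trick), which is what makes the bound uniform in `N`;
* `discrepancy_le_of_box`, `kick_discrepancy_le_of_box` — at the bond site `i ≤ L`: for initial data differing only in
  the contact momentum (the resampled kick of C′), `Λ|δq_i(t)| + |δp_i(t)| ≤ (θ^i |p_0 - p_0'| + 2RΛ²θ^{|L-i|} t) e^{Λ(4+2/θ)t}`
  — the kick is damped by `θ^i`, and optimising `θ⁻¹ ≍ i/(Λ t)` gives the `(eΛt/i)^i`-type cone factor.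

What this does NOT do: control the Gibbs probability of the box event (the maximal inequality for sup-in-time local
energies along the closed flow — the probabilistic half of any cold-cone bound), nor the linear window of the stub.
References: MPPT 1978; BCDM 2007 §3; Raz–Sims 2009 §4; folklore. Nothing here closes the item.
-/

noncomputable section

open MeasureTheory Filter Topology Set Function Metric
open scoped NNReal

namespace Summit.AtomisticToContinuum.FouriersLaw.Theorems.OddSectorIrreversibility.TapLeak

open Literature.MathematicalPhysics.KineticTheory.HeatConduction
open Literature.MathematicalPhysics.KineticTheory

/-! ### §5 The block light cone -/

/-- Geometric two-sided weights `θ^{|n-i|}` lose at most a factor `θ` per step. [folklore] -/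
theorem weight_step {θ : ℝ} (hθ0 : 0 ≤ θ) (hθ1 : θ ≤ 1) (n i : ℕ) :
    θ * θ ^ Nat.dist n i ≤ θ ^ Nat.dist (n + 1) i ∧ θ * θ ^ Nat.dist (n + 1) i ≤ θ ^ Nat.dist n i := by
  have h1 : Nat.dist (n + 1) i ≤ Nat.dist n i + 1 := by unfold Nat.dist; omega
  have h2 : Nat.dist n i ≤ Nat.dist (n + 1) i + 1 := by unfold Nat.dist; omega
  constructor
  · rw [← pow_succ']; exact pow_le_pow_of_le_one hθ0 hθ1 h1
  · rw [← pow_succ']; exact pow_le_pow_of_le_one hθ0 hθ1 h2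

section Block

open Summit.AtomisticToContinuum.FouriersLaw.Theorems.ClosedConeSensitivity.Negative.ZeroFrictionDictionary
open Summit.AtomisticToContinuum.FouriersLaw.Theorems.OddSectorIrreversibility.Corrector

variable {ω₂ lam β : ℝ} (hω : 0 < ω₂) (hl : 0 ≤ lam) (hβ : 0 ≤ β) {N : ℕ} (x y : PhaseSpace N)
  (dq dp : ℕ → ℝ → ℝ)
  (hdq : ∀ n τ, dq n τ = if h : n < N then
    |(detFlow ω₂ lam β N τ x).1 ⟨n, h⟩ - (detFlow ω₂ lam β N τ y).1 ⟨n, h⟩| else 0)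
  (hdp : ∀ n τ, dp n τ = if h : n < N then
    |(detFlow ω₂ lam β N τ x).2 ⟨n, h⟩ - (detFlow ω₂ lam β N τ y).2 ⟨n, h⟩| else 0)
include hω hl hβ hdq hdp

omit hω hl hβ hdp in
/-- `dq ≥ 0`. [folklore] -/
theorem dq_nonneg (n : ℕ) (τ : ℝ) : 0 ≤ dq n τ := by
  rw [hdq]; split_ifs <;> simp [abs_nonneg]

omit hω hl hβ hdq in
/-- `dp ≥ 0`. [folklore] -/
theorem dp_nonneg (n : ℕ) (τ : ℝ) : 0 ≤ dp n τ := by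
  rw [hdp]; split_ifs <;> simp [abs_nonneg]

omit hdp in
/-- `dq n` is continuous in time. [folklore] -/
theorem continuous_dq (n : ℕ) : Continuous (dq n) := by
  by_cases h : n < N
  · have : dq n = fun τ => |(detFlow ω₂ lam β N τ x).1 ⟨n, h⟩ - (detFlow ω₂ lam β N τ y).1 ⟨n, h⟩| := by
      funext τ; rw [hdq, dif_pos h]
    rw [this]
    exact ((continuous_detFlow_fst_apply hω hl hβ N x _).sub (continuous_detFlow_fst_apply hω hl hβ N y _)).abs
  · have : dq n = fun _ => 0 := by funext τ; rw [hdq, dif_neg h]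
    rw [this]; exact continuous_const

omit hdq in
/-- `dp n` is continuous in time. [folklore] -/
theorem continuous_dp (n : ℕ) : Continuous (dp n) := by
  by_cases h : n < N
  · have : dp n = fun τ => |(detFlow ω₂ lam β N τ x).2 ⟨n, h⟩ - (detFlow ω₂ lam β N τ y).2 ⟨n, h⟩| := by
      funext τ; rw [hdp, dif_pos h]
    rw [this]
    exact ((continuous_detFlow_snd_apply hω hl hβ N x _).sub (continuous_detFlow_snd_apply hω hl hβ N y _)).abs
  · have : dp n = fun _ => 0 := by funext τ; rw [hdp, dif_neg h]
    rw [this]; exact continuous_const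

/-- Position discrepancy: `dq_n(t) ≤ dq_n(0) + ∫₀ᵗ dp_n`. [folklore] -/
theorem dq_le {n : ℕ} (hn : n < N) {t : ℝ} (ht : 0 ≤ t) :
    dq n t ≤ dq n 0 + ∫ τ in (0 : ℝ)..t, dp n τ := by
  have h := abs_sub_fst_le hω hl hβ N x y ⟨n, hn⟩ ht
  have hI : ∫ τ in (0 : ℝ)..t, dp n τ =
      ∫ τ in (0 : ℝ)..t, |(detFlow ω₂ lam β N τ x).2 ⟨n, hn⟩ - (detFlow ω₂ lam β N τ y).2 ⟨n, hn⟩| :=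
    intervalIntegral.integral_congr fun τ _ => by simp only [hdp, dif_pos hn]
  rw [hdq, dif_pos hn, hdq, dif_pos hn, hI, detFlow_of_nonpos (ω₂ := ω₂) (lam := lam) (β := β) N le_rfl x,
    detFlow_of_nonpos (ω₂ := ω₂) (lam := lam) (β := β) N le_rfl y]
  exact h

/-- Momentum discrepancy inside the block, positions boxed on the sites `≤ L+1` during `[0, s]`:
`dp_n(t) ≤ dp_n(0) + ∫₀ᵗ Λ²(dq_{n-1} + 3 dq_n + dq_{n+1})` for `n ≤ L`, `n < N`, `t ∈ [0, s]`
(at `n = 0` the term `dq_{n-1} = dq_0` only over-counts). [folklore] -/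
theorem dp_le_box {R Λ : ℝ} {L : ℕ} {s : ℝ} (hΛU : |ω₂| + 3 * lam * R ^ 2 ≤ Λ ^ 2)
    (hΛV : 1 + 12 * β * R ^ 2 ≤ Λ ^ 2)
    (hbox : ∀ τ ∈ Icc 0 s, ∀ (n : ℕ) (h : n < N), n ≤ L + 1 →
      |(detFlow ω₂ lam β N τ x).1 ⟨n, h⟩| ≤ R ∧ |(detFlow ω₂ lam β N τ y).1 ⟨n, h⟩| ≤ R)
    {n : ℕ} (hn : n < N) (hnL : n ≤ L) {t : ℝ} (ht : t ∈ Icc 0 s) :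
    dp n t ≤ dp n 0 + ∫ τ in (0 : ℝ)..t, Λ ^ 2 * (dq (n - 1) τ + 3 * dq n τ + dq (n + 1) τ) := by
  have h := abs_sub_snd_le hω hl hβ N x y ⟨n, hn⟩ ht.1
  rw [hdp, dif_pos hn, hdp, dif_pos hn, detFlow_of_nonpos (ω₂ := ω₂) (lam := lam) (β := β) N le_rfl x,
    detFlow_of_nonpos (ω₂ := ω₂) (lam := lam) (β := β) N le_rfl y]
  refine h.trans ?_
  gcongr ?_ + ?_
  · exact le_rfl
  have hcq : ∀ m, Continuous (dq m) := continuous_dq hω hl hβ x y dq hdq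
  refine intervalIntegral.integral_mono_on ht.1 ?_ ?_ fun τ hτ => ?_
  · exact (((continuous_dPotential_detFlow hω hl hβ N x _).sub
      (continuous_dPotential_detFlow hω hl hβ N y _)).abs).intervalIntegrable _ _
  · exact ((((hcq _).add ((hcq _).const_mul 3)).add (hcq _)).const_mul _).intervalIntegrable _ _
  -- pointwise force bound at time `τ ∈ [0, t] ⊆ [0, s]`
  have hτs : τ ∈ Icc 0 s := ⟨hτ.1, hτ.2.trans ht.2⟩
  set q := (detFlow ω₂ lam β N τ x).1 with hq
  set q' := (detFlow ω₂ lam β N τ y).1 with hq'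
  have hk := hbox τ hτs n hn (by omega)
  have hkm : ∀ h : 0 < (⟨n, hn⟩ : Fin N).val, |q ⟨(⟨n, hn⟩ : Fin N).val - 1, by simp; omega⟩| ≤ R ∧
      |q' ⟨(⟨n, hn⟩ : Fin N).val - 1, by simp; omega⟩| ≤ R := fun h => hbox τ hτs (n - 1) (by omega) (by omega)
  have hkp : ∀ h : (⟨n, hn⟩ : Fin N).val + 1 < N, |q ⟨(⟨n, hn⟩ : Fin N).val + 1, h⟩| ≤ R ∧
      |q' ⟨(⟨n, hn⟩ : Fin N).val + 1, h⟩| ≤ R := fun h => hbox τ hτs (n + 1) h (by simp; omega)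
  have hF := abs_dPotential_sub_le hl hβ hΛU hΛV q q' ⟨n, hn⟩ hk hkm hkp
  refine hF.trans ?_
  have hΛ2 : 0 ≤ Λ ^ 2 := sq_nonneg _
  have e0 : |q ⟨n, hn⟩ - q' ⟨n, hn⟩| = dq n τ := by rw [hdq, dif_pos hn]
  have h1 : (if h : 0 < (⟨n, hn⟩ : Fin N).val then Λ ^ 2 * (|q ⟨n, hn⟩ - q' ⟨n, hn⟩| +
      |q ⟨(⟨n, hn⟩ : Fin N).val - 1, by simp; omega⟩ - q' ⟨(⟨n, hn⟩ : Fin N).val - 1, by simp; omega⟩|) else 0) ≤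
      Λ ^ 2 * (dq n τ + dq (n - 1) τ) := by
    by_cases h : 0 < n
    · rw [dif_pos h]
      have e1 : |q ⟨(⟨n, hn⟩ : Fin N).val - 1, by simp; omega⟩ - q' ⟨(⟨n, hn⟩ : Fin N).val - 1, by simp; omega⟩| =
          dq (n - 1) τ := by
        rw [hdq, dif_pos (by omega : n - 1 < N)]
      rw [e0, e1]
    · rw [dif_neg h]
      have := dq_nonneg x y dq hdq n τ; have := dq_nonneg x y dq hdq (n - 1) τ
      positivity
  have h2 : (if h : (⟨n, hn⟩ : Fin N).val + 1 < N then Λ ^ 2 * (|q ⟨(⟨n, hn⟩ : Fin N).val + 1, h⟩ -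
      q' ⟨(⟨n, hn⟩ : Fin N).val + 1, h⟩| + |q ⟨n, hn⟩ - q' ⟨n, hn⟩|) else 0) ≤ Λ ^ 2 * (dq (n + 1) τ + dq n τ) := by
    by_cases h : n + 1 < N
    · rw [dif_pos h]
      have e1 : |q ⟨(⟨n, hn⟩ : Fin N).val + 1, h⟩ - q' ⟨(⟨n, hn⟩ : Fin N).val + 1, h⟩| = dq (n + 1) τ := by
        rw [hdq, dif_pos h]
      rw [e0, e1]
    · rw [dif_neg h]
      have := dq_nonneg x y dq hdq n τ; have := dq_nonneg x y dq hdq (n + 1) τ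
      positivity
  rw [e0] at *
  nlinarith [h1, h2, dq_nonneg x y dq hdq n τ]


/-- The combined discrepancy `a_n = Λ dq_n + dp_n` inside the block:
`a_n(t) ≤ a_n(0) + ∫₀ᵗ (Λ(a_{n-1} + 3 a_n) + Λ² dq_{n+1})` for every `n ≤ L` and `t ∈ [0, s]` (`Λ ≥ 1`). [folklore] -/
theorem a_le_box {R Λ : ℝ} {L : ℕ} {s : ℝ} (hΛ1 : 1 ≤ Λ) (hΛU : |ω₂| + 3 * lam * R ^ 2 ≤ Λ ^ 2)
    (hΛV : 1 + 12 * β * R ^ 2 ≤ Λ ^ 2)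
    (hbox : ∀ τ ∈ Icc 0 s, ∀ (n : ℕ) (h : n < N), n ≤ L + 1 →
      |(detFlow ω₂ lam β N τ x).1 ⟨n, h⟩| ≤ R ∧ |(detFlow ω₂ lam β N τ y).1 ⟨n, h⟩| ≤ R)
    (a : ℕ → ℝ → ℝ) (ha : ∀ n τ, a n τ = Λ * dq n τ + dp n τ)
    {n : ℕ} (hnL : n ≤ L) {t : ℝ} (ht : t ∈ Icc 0 s) :
    a n t ≤ a n 0 + ∫ τ in (0 : ℝ)..t, (Λ * (a (n - 1) τ + 3 * a n τ) + Λ ^ 2 * dq (n + 1) τ) := by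
  have hΛ0 : 0 ≤ Λ := zero_le_one.trans hΛ1
  have hcq : ∀ m, Continuous (dq m) := continuous_dq hω hl hβ x y dq hdq
  have hcp : ∀ m, Continuous (dp m) := continuous_dp hω hl hβ x y dp hdp
  have hca : ∀ m, Continuous (a m) := fun m => by
    have : a m = fun τ => Λ * dq m τ + dp m τ := funext fun τ => ha m τ
    rw [this]; exact ((hcq m).const_mul Λ).add (hcp m)
  have hq0 : ∀ m τ, 0 ≤ dq m τ := dq_nonneg x y dq hdq
  have hp0 : ∀ m τ, 0 ≤ dp m τ := dp_nonneg x y dp hdp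
  have hRHS0 : ∀ τ, 0 ≤ Λ * (a (n - 1) τ + 3 * a n τ) + Λ ^ 2 * dq (n + 1) τ := fun τ => by
    rw [ha, ha]
    have := hq0 (n - 1) τ; have := hq0 n τ; have := hq0 (n + 1) τ; have := hp0 (n - 1) τ; have := hp0 n τ
    positivity
  have hint : IntervalIntegrable (fun τ => Λ * (a (n - 1) τ + 3 * a n τ) + Λ ^ 2 * dq (n + 1) τ) volume 0 t :=
    ((((hca _).add ((hca _).const_mul 3)).const_mul Λ).add ((hcq _).const_mul _)).intervalIntegrable _ _
  by_cases hn : n < N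
  · have h1 := dq_le hω hl hβ x y dq dp hdq hdp hn ht.1
    have h2 := dp_le_box hω hl hβ x y dq dp hdq hdp hΛU hΛV hbox hn hnL ht
    have hip : IntervalIntegrable (dp n) volume 0 t := (hcp n).intervalIntegrable _ _
    have hif : IntervalIntegrable (fun τ => Λ ^ 2 * (dq (n - 1) τ + 3 * dq n τ + dq (n + 1) τ)) volume 0 t :=
      ((((hcq _).add ((hcq _).const_mul 3)).add (hcq _)).const_mul _).intervalIntegrable _ _
    -- combine the two inequalities
    have h3 : a n t ≤ a n 0 + ∫ τ in (0 : ℝ)..t,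
        (Λ * dp n τ + Λ ^ 2 * (dq (n - 1) τ + 3 * dq n τ + dq (n + 1) τ)) := by
      rw [ha, ha, intervalIntegral.integral_add (hip.const_mul Λ) hif, intervalIntegral.integral_const_mul]
      have := mul_le_mul_of_nonneg_left h1 hΛ0
      linarith
    refine h3.trans ?_
    gcongr ?_ + ?_
    · exact le_rfl
    refine intervalIntegral.integral_mono_on ht.1 ((hip.const_mul Λ).add hif) hint fun τ _ => ?_
    rw [ha (n - 1), ha n]
    have := hq0 (n - 1) τ; have := hp0 (n - 1) τ; have := hp0 n τ; have := hq0 n τ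
    nlinarith
  · -- outside the chain: `a n ≡ 0`
    have hz : ∀ τ, a n τ = 0 := fun τ => by
      rw [ha, hdq, hdp, dif_neg hn, dif_neg hn]; ring
    rw [hz, hz]
    have := intervalIntegral.integral_nonneg (μ := volume) ht.1 (fun τ _ => hRHS0 τ)
    linarith

omit hω hl hβ hdp in
/-- The block-boundary cap: `dq_{L+1} ≤ 2R` on `[0, s]` (the site `L+1` is in the box, or beyond the chain). [folklore] -/
theorem dq_succ_le_two_mul {R : ℝ} {L : ℕ} {s : ℝ} (hR : 0 ≤ R)
    (hbox : ∀ τ ∈ Icc 0 s, ∀ (n : ℕ) (h : n < N), n ≤ L + 1 →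
      |(detFlow ω₂ lam β N τ x).1 ⟨n, h⟩| ≤ R ∧ |(detFlow ω₂ lam β N τ y).1 ⟨n, h⟩| ≤ R)
    {τ : ℝ} (hτ : τ ∈ Icc 0 s) : dq (L + 1) τ ≤ 2 * R := by
  rw [hdq]
  by_cases h : L + 1 < N
  · rw [dif_pos h]
    have hb := hbox τ hτ (L + 1) h le_rfl
    exact (abs_sub _ _).trans (by linarith [hb.1, hb.2])
  · rw [dif_neg h]; linarith

end Block


/-! ### Registered sub-goal of the line (closed form of `a_le_box`) -/

/-- **Sub-goal `stub_blockSiteInequality`** (registered on the crux item for this helper file; closed `∀`-form of `a_le_box`):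
the per-site integral inequality of the combined discrepancy inside a boxed block. [folklore] -/
theorem stub_blockSiteInequality : ∀ (ω₂ lam β : ℝ), 0 < ω₂ → 0 ≤ lam → 0 ≤ β → ∀ (N : ℕ) (x y : PhaseSpace N) (dq dp : ℕ → ℝ → ℝ), (∀ (n : ℕ) (τ : ℝ), dq n τ = if h : n < N then |(Summit.AtomisticToContinuum.FouriersLaw.Theorems.ClosedConeSensitivity.Negative.ZeroFrictionDictionary.detFlow ω₂ lam β N τ x).1 ⟨n, h⟩ - (Summit.AtomisticToContinuum.FouriersLaw.Theorems.ClosedConeSensitivity.Negative.ZeroFrictionDictionary.detFlow ω₂ lam β N τ y).1 ⟨n, h⟩| else 0) → (∀ (n : ℕ) (τ : ℝ), dp n τ = if h : n < N then |(Summit.AtomisticToContinuum.FouriersLaw.Theorems.ClosedConeSensitivity.Negative.ZeroFrictionDictionary.detFlow ω₂ lam β N τ x).2 ⟨n, h⟩ - (Summit.AtomisticToContinuum.FouriersLaw.Theorems.ClosedConeSensitivity.Negative.ZeroFrictionDictionary.detFlow ω₂ lam β N τ y).2 ⟨n, h⟩| else 0) → ∀ (R Λ : ℝ) (L : ℕ)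 (s : ℝ), 1 ≤ Λ → |ω₂| + 3 * lam * R ^ 2 ≤ Λ ^ 2 → 1 + 12 * β * R ^ 2 ≤ Λ ^ 2 → (∀ τ ∈ Set.Icc (0 : ℝ) s, ∀ (n : ℕ) (h : n < N), n ≤ L + 1 → |(Summit.AtomisticToContinuum.FouriersLaw.Theorems.ClosedConeSensitivity.Negative.ZeroFrictionDictionary.detFlow ω₂ lam β N τ x).1 ⟨n, h⟩| ≤ R ∧ |(Summit.AtomisticToContinuum.FouriersLaw.Theorems.ClosedConeSensitivity.Negative.ZeroFrictionDictionary.detFlow ω₂ lam β N τ y).1 ⟨n, h⟩| ≤ R) → ∀ (a : ℕ → ℝ → ℝ), (∀ (n : ℕ) (τ : ℝ), a n τ = Λ * dq n τ + dp n τ) → ∀ (n : ℕ), n ≤ L → ∀ (t : ℝ), t ∈ Set.Icc (0 : ℝ) s → a n t ≤ a n 0 + ∫ τ in (0 : ℝ)..t, (Λ * (a (n - 1) τ + 3 * a n τ) + Λ ^ 2 * dq (n + 1) τ) :=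
  fun _ _ _ hω hl hβ _ x y dq dp hdq hdp _ _ _ _ hΛ1 hΛU hΛV hbox a ha _ hnL _ ht =>
    a_le_box hω hl hβ x y dq dp hdq hdp hΛ1 hΛU hΛV hbox a ha hnL ht

end Summit.AtomisticToContinuum.FouriersLaw.Theorems.OddSectorIrreversibility.TapLeak

end
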